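import Literature.NumberTheory.LFunctions.FordRoughNumbers
import Literature.NumberTheory.LFunctions.FordSmoothNumbers
import HarnessLib

/-!
# `FordVK.calC = FordSmooth.smoothSet`: the two in-tree spellings of Ford's `𝒞(P,R)` agree

Topic `Literature/NumberTheory/LFunctions`. Pure proof file (bridge lemmas, no facts).

Ford's set `𝒞(P,R) = {1 ≤ n ≤ P : p ∣ n ⟹ √R < p ≤ R}` (K. Ford, Proc. LMS 85 (2002), §2) is in
the tree twice: `FordVK.calC` (`FordRoughNumbers.lean`, used by the §5 chain
`FordVK.sec5_interval` … `zero_bound_large_height_mty_of_theorem3_theorem4`, whose hypothesis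
`hT4` = Theorem 4 of the source is stated over `FordVK.calC P (P^η)`) and `FordSmooth.smoothSet`
(`FordSmoothNumbers.lean`, Lemmas 2.2–2.3 of the source with Chebyshev–Sylvester inputs). They are
the same finset (`FordVK.calC_eq_smoothSet`), so a Theorem 4 proved over either set discharges
`hT4`.

## References
* K. Ford, Proc. London Math. Soc. (3) 85 (2002), 565–633, §2 (definition of `𝒞(P,R)`). [Ford2002]
-/

noncomputable section

open Finset

namespace Literature.NumberTheory.LFunctions

/-- **The two spellings of `𝒞(P,R)` agree.** [cite: Ford2002, §2 (definition of `𝒞(P,R)`)] -/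
theorem FordVK.calC_eq_smoothSet (P R : ℝ) : FordVK.calC P R = FordSmooth.smoothSet P R := by
  ext n
  simp only [FordVK.calC, FordSmooth.smoothSet, FordSmooth.GoodFactors, mem_filter]

/-- Membership form of the bridge. [cite: Ford2002, §2] -/
theorem FordVK.mem_calC_iff_mem_smoothSet {P R : ℝ} {n : ℕ} :
    n ∈ FordVK.calC P R ↔ n ∈ FordSmooth.smoothSet P R := by
  rw [FordVK.calC_eq_smoothSet]

end Literature.NumberTheory.LFunctions
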